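import Summits.BirchSwinnertonDyer.BirchSwinnertonDyer.Theses.AdditiveBranchIMC
import Literature.NumberTheory.EllipticCurves.RankinSelbergBaseChangeDirichlet

/-!
# K1 route `AdditiveBranchIMC` — alias leaf 19491 `RankinSelbergBaseChangeDirichlet` of the tenure split of
# crux `GordTwoRankOne` (item 19358), DISCHARGED (cell `bsd-addord`, seat `bsd-addord-k1-c4` gen 3)

Item `stmt-BirchSwinnertonDyer-19491` (support, cite-only alias leaf, K1 rev 7):
`RankinSelbergBaseChangeDirichlet := Literature.NumberTheory.EllipticCurves.rankinSelbergEulerProductHecke_baseChangeDirichlet_eq`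
— the Artin-formalism factorisation of the Rankin–Selberg Euler product of `f × θ` through the base change
to the quadratic field (binder `hArt` of `gordTwoRankOne_of_parts`). The Literature fact is now a tree THEOREM
(`rankinSelbergEulerProductHecke_baseChangeDirichlet_eq_holds`, `Literature/NumberTheory/EllipticCurves/RankinSelbergBaseChangeDirichlet.lean`,
lit g17 p433990 + sequel), so the route declaration holds outright. Director-bsd 2026-08-26T12:28:53Z asked the
first idle prover hand to land this one-line wrapper. Nothing about any curve of the cell is asserted; BSD is not
touched.
-/

set_option autoImplicit false
set_option linter.dupNamespace false

namespace Summit.BirchSwinnertonDyer.BirchSwinnertonDyer.Theorems.AdditiveBranchIMCRankinSelbergBaseChangeDirichlet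

open Summit.BirchSwinnertonDyer.BirchSwinnertonDyer.Theses.AdditiveBranchIMC

/-- **Item 19491 holds**: the route's alias leaf `RankinSelbergBaseChangeDirichlet` is, by definition, the
Literature statement `rankinSelbergEulerProductHecke_baseChangeDirichlet_eq`, which is proved in the tree
(`…_holds`: Euler-factor bookkeeping over the places of the quadratic field). [cite: Gross2004, §3 (p. 40) and §13 (p. 49)]
[cite: NeukirchANT1999, Ch. VII (10.4) (iv)] -/
theorem rankinSelbergBaseChangeDirichlet_proof : RankinSelbergBaseChangeDirichlet :=
  Literature.NumberTheory.EllipticCurves.rankinSelbergEulerProductHecke_baseChangeDirichlet_eq_holds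

end Summit.BirchSwinnertonDyer.BirchSwinnertonDyer.Theorems.AdditiveBranchIMCRankinSelbergBaseChangeDirichlet
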